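import Literature.Analysis.Calculus.LineIntegrationBootstrapJets     -- ★ p846509 (F0P3a-p02 (g14)): `hasDerivAt_iteratedFDeriv_apply_line`
import Mathlib.Analysis.Calculus.Taylor
import Mathlib.Analysis.Calculus.MeanValue
import Mathlib.Topology.ExtendFrom
import HarnessLib

/-!
# Jets up to the corner of a convex region: boundary limits, Taylor along the wall, and the CORNER TRANSFER of third jets across a common wall (jet form, no extension theorem)
# (Warner, *Harmonic Analysis on Semi-Simple Lie Groups II* §8.5.1, proof of Thm. 8.5.1.9 «the usual Lipschitz argument»; Dieudonné, *Foundations* VIII §12, (8.14.3) Taylor's formula)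

Topic `Analysis/Calculus`; namespace `Literature.Analysis.Calculus`.  THEOREMS ONLY (no `def`, no instance, no notation, no axiom, no named fact, no `sorry`); generic real normed spaces.
Cell `pub/hodgecm-mathlib`, ENGINE T1 (crux H413 = `stmt-HodgeConjecture-24833`); ROAD «A6-IV» brick (f2) FILE 3a (owner∕architect F0P3a-p05 (g15), R-15.10 (1) «(f1)(f2) = p02»); pen F0P3a-p02 (g15),
2026-09-01.  Consumer: FILE 3b `Rogawski1990/ArchCentralLimitChamberValueMid` (the letter's value on the two doubly-noncompact chambers).

THE MATHEMATICS.  `K` is an OPEN CONVEX bounded region (a Weyl chamber cut by a ball), `f` is `C⁴` on `K` with `‖D⁴f‖ ≤ M` there — the output of Harish-Chandra's theorem (Warner 8.4.3.1 ∕ 8.5.1.1,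
the cell's (d2)+(f1)).  Then (§1–§2) every `Dᵏf`, `k ≤ 3`, is bounded and Lipschitz on `K`, hence HAS A LIMIT at every point of `closure K` from inside `K` (Cauchy filter in a complete space), and
`extendFrom K (D³f)` is continuous on `closure K`.  (§3) TAYLOR ALONG A SEGMENT `[y, y + t•v] ⊆ K` for the first jet: `D¹f(y+tv)[N] = D¹f(y)[N] + t·D²f(y)[v,N] + (t²∕2)·D³f(y)[v,v,N] + O(M‖v‖³‖N‖t³)`
(one-variable Taylor with the `iteratedDerivWithin` remainder bound, Mathlib `taylor_mean_remainder_bound`, along `τ ↦ D¹f(y+τv)[N]` whose `τ`-derivatives are the higher jets, ★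
`hasDerivAt_iteratedFDeriv_apply_line`); (§5) the same inequality survives in the LIMIT at boundary points (`y → x₀ ∈ closure K` inside `K`); (§4) a vector polynomial `a + tb + t²c` which is
`O(t³)` on `(0,δ)` vanishes identically.  (§6) **THE CORNER TRANSFER** `cornerJet_transfer`: two such regions `K₁, K₂` with the corner `0` and the punctured wall ray `{t•u : 0 < t < δ}` in
both closures; IF along that ray the boundary limits of the FIRST jets from the two sides agree on the normal `N` and those of the THIRD jets agree on `(N,N,N)` (Harish-Chandra: odd normal
derivatives are continuous across a noncompact wall), THEN the two CORNER limits `J, J′` of `D³f` satisfy `J[N,N,N] = J′[N,N,N]` (continuity of `extendFrom` at the corner) and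
`J[u,u,N] = J′[u,u,N]` (Taylor along the wall from the corner on both sides, subtract, §4) — exactly the two jets the letter's functional `ω = ¼·N′(N′² − A′²)` reads (★ (h4)
`sum_sign_cube_signedRay_eq_wall02_of_symmetric`).  This replaces the `C³` corner EXTENSIONS of ★ (h4) `lambda8Angle_zero_eq_of_wall02_oddJets_of_isOpen` by jet limits.
HONEST LABEL: HC_CM is proved only modulo the printed citations until rung 0 closes; generic calculus, pays nothing by itself.

## References
* [WarnerHASSLG2] G. Warner, *Harmonic Analysis on Semi-Simple Lie Groups II*, Grundlehren 189 (1972), §8.5.1 (proof of Thm. 8.5.1.9).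
* [Dieudonne1960] J. Dieudonné, *Foundations of Modern Analysis* (1960), Ch. VIII §14 (8.14.3) (Taylor's formula with integral remainder), §12.
* [Rudin1976] W. Rudin, *Principles of Mathematical Analysis*, 3rd ed. (1976), Thm. 5.15 (Taylor), Thm. 9.19 (mean value inequality).
-/

set_option autoImplicit false

noncomputable section

open Filter Topology Set Function Metric
open Literature.Analysis.Calculus.LineBootstrap
open scoped NNReal Nat

namespace Literature.Analysis.Calculus

variable {E F : Type*} [NormedAddCommGroup E] [NormedSpace ℝ E] [NormedAddCommGroup F] [NormedSpace ℝ F]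

/-! ## §1 A derivative bound on an open convex set gives limits at every point of the closure -/

section Limits

variable [CompleteSpace F]

/-- **LIPSCHITZ ⇒ BOUNDARY LIMITS**: `g` differentiable on an open convex `K` with `‖Dg‖ ≤ M` has a limit at every `x ∈ closure K` from inside `K` (mean-value Lipschitz bound, Cauchy filter,
completeness). [cite: WarnerHASSLG2, §8.5.1 proof of Thm. 8.5.1.9] [cite: Rudin1976, Thm. 9.19] -/
theorem exists_tendsto_nhdsWithin_of_fderiv_bound {g : E → F} {K : Set E} (hK : IsOpen K) (hKc : Convex ℝ K)
    (hg : DifferentiableOn ℝ g K) {M : ℝ≥0} (hM : ∀ y ∈ K, ‖fderiv ℝ g y‖₊ ≤ M) {x : E} (hx : x ∈ closure K) :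
    ∃ L : F, Tendsto g (𝓝[K] x) (𝓝 L) := by
  haveI hne : (𝓝[K] x).NeBot := mem_closure_iff_nhdsWithin_neBot.1 hx
  have hlip : LipschitzOnWith M g K :=
    hKc.lipschitzOnWith_of_nnnorm_fderiv_le (fun y hy => (hg y hy).differentiableAt (hK.mem_nhds hy)) hM
  have hcau : Cauchy (𝓝[K] x) := cauchy_nhds.mono' hne nhdsWithin_le_nhds
  have hpr : 𝓝[K] x ≤ 𝓟 K := le_principal_iff.2 self_mem_nhdsWithin
  have hle : 𝓝[K] x ×ˢ 𝓝[K] x ≤ uniformity E ⊓ 𝓟 (K ×ˢ K) :=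
    le_inf hcau.2 (by rw [← prod_principal_principal]; exact Filter.prod_mono hpr hpr)
  have hmap : Cauchy (map g (𝓝[K] x)) := cauchy_map_iff'.2 ((hlip.uniformContinuousOn).mono_left hle)
  exact cauchy_iff_exists_le_nhds.1 hmap

/-- **BOUNDED `Dᵏ⁺¹f` ON AN OPEN CONVEX `K` ⇒ `Dᵏf` HAS A LIMIT AT EVERY POINT OF `closure K`** (Warner's Lipschitz argument, any base point). [cite: WarnerHASSLG2, §8.5.1 proof of Thm. 8.5.1.9] -/
theorem exists_tendsto_iteratedFDeriv_nhdsWithin_closure {f : E → F} {K : Set E} (hK : IsOpen K) (hKc : Convex ℝ K)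
    {k : ℕ} (hf : ContDiffOn ℝ (k + 1) f K) {M : ℝ} (hM : ∀ y ∈ K, ‖iteratedFDeriv ℝ (k + 1) f y‖ ≤ M) {x : E} (hx : x ∈ closure K) :
    ∃ L : ContinuousMultilinearMap ℝ (fun _ : Fin k => E) F, Tendsto (iteratedFDeriv ℝ k f) (𝓝[K] x) (𝓝 L) := by
  refine exists_tendsto_nhdsWithin_of_fderiv_bound hK hKc (M := Real.toNNReal M) ?_ (fun y hy => ?_) hx
  · intro y hy
    exact ((hf.contDiffAt (hK.mem_nhds hy)).differentiableAt_iteratedFDeriv (by exact_mod_cast Nat.lt_succ_self k)).differentiableWithinAt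
  · rw [← NNReal.coe_le_coe, coe_nnnorm, norm_fderiv_iteratedFDeriv, Real.coe_toNNReal']
    exact (hM y hy).trans (le_max_left _ _)

end Limits

/-! ## §2 Lower-order jets are bounded too (mean value on a bounded convex set) -/

section Lower

/-- One step down: `‖Dᵏ⁺¹f‖ ≤ M` on an open convex `K` of diameter `≤ R` ⇒ `Dᵏf` bounded on `K`. [cite: Rudin1976, Thm. 9.19] -/
theorem exists_bound_iteratedFDeriv_of_bound_succ {f : E → F} {K : Set E} (hK : IsOpen K) (hKc : Convex ℝ K) {R : ℝ} (hR : ∀ x ∈ K, ∀ y ∈ K, ‖y - x‖ ≤ R)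
    {k : ℕ} (hf : ContDiffOn ℝ (k + 1) f K) {M : ℝ} (hM : ∀ y ∈ K, ‖iteratedFDeriv ℝ (k + 1) f y‖ ≤ M) :
    ∃ M' : ℝ, ∀ y ∈ K, ‖iteratedFDeriv ℝ k f y‖ ≤ M' := by
  rcases K.eq_empty_or_nonempty with hKe | ⟨x₀, hx₀⟩
  · exact ⟨0, fun y hy => by simp [hKe] at hy⟩
  have hdiff : ∀ y ∈ K, DifferentiableAt ℝ (iteratedFDeriv ℝ k f) y := fun y hy =>
    (hf.contDiffAt (hK.mem_nhds hy)).differentiableAt_iteratedFDeriv (by exact_mod_cast Nat.lt_succ_self k)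
  have hbd : ∀ y ∈ K, ‖fderiv ℝ (iteratedFDeriv ℝ k f) y‖ ≤ M := fun y hy => by
    rw [norm_fderiv_iteratedFDeriv]; exact hM y hy
  have hM0 : 0 ≤ M := (norm_nonneg _).trans (hM x₀ hx₀)
  refine ⟨‖iteratedFDeriv ℝ k f x₀‖ + M * R, fun y hy => ?_⟩
  have h := hKc.norm_image_sub_le_of_norm_fderiv_le hdiff hbd hx₀ hy
  calc ‖iteratedFDeriv ℝ k f y‖ = ‖iteratedFDeriv ℝ k f x₀ + (iteratedFDeriv ℝ k f y - iteratedFDeriv ℝ k f x₀)‖ := by rw [add_sub_cancel]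
    _ ≤ ‖iteratedFDeriv ℝ k f x₀‖ + ‖iteratedFDeriv ℝ k f y - iteratedFDeriv ℝ k f x₀‖ := norm_add_le _ _
    _ ≤ ‖iteratedFDeriv ℝ k f x₀‖ + M * ‖y - x₀‖ := by gcongr
    _ ≤ ‖iteratedFDeriv ℝ k f x₀‖ + M * R := by gcongr; exact hR x₀ hx₀ y hy

/-- All orders `k ≤ n` at once: `‖Dⁿf‖ ≤ M` on an open convex bounded `K` ⇒ every `Dᵏf`, `k ≤ n`, is bounded on `K`. [cite: Rudin1976, Thm. 9.19] -/
theorem exists_bound_iteratedFDeriv_of_le {f : E → F} {K : Set E} (hK : IsOpen K) (hKc : Convex ℝ K) {R : ℝ} (hR : ∀ x ∈ K, ∀ y ∈ K, ‖y - x‖ ≤ R)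
    {n : ℕ} (hf : ContDiffOn ℝ n f K) {M : ℝ} (hM : ∀ y ∈ K, ‖iteratedFDeriv ℝ n f y‖ ≤ M) :
    ∀ k ≤ n, ∃ M' : ℝ, ∀ y ∈ K, ‖iteratedFDeriv ℝ k f y‖ ≤ M' := by
  suffices h : ∀ d k : ℕ, k + d = n → ∃ M' : ℝ, ∀ y ∈ K, ‖iteratedFDeriv ℝ k f y‖ ≤ M' from
    fun k hk => h (n - k) k (by omega)
  intro d
  induction d with
  | zero =>
    intro k hk
    obtain rfl : k = n := by omega
    exact ⟨M, hM⟩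
  | succ d ih =>
    intro k hk
    obtain ⟨M', hM'⟩ := ih (k + 1) (by omega)
    exact exists_bound_iteratedFDeriv_of_bound_succ hK hKc hR (hf.of_le (by exact_mod_cast (by omega : k + 1 ≤ n))) hM'

end Lower

/-! ## §3 Taylor along a segment inside `K` for the first jet, with the `D⁴` remainder -/

section Taylor

/-- **TAYLOR ALONG A SEGMENT FOR THE FIRST JET.**  `f` of class `C⁴` on an open `K` with `‖D⁴f‖ ≤ M`, `[y, y + t•v] ⊆ K` (`t > 0`), `N` any vector:
`‖D¹f(y+tv)[N] − (D¹f(y)[N] + t·D²f(y)[v,N] + (t²∕2)·D³f(y)[v,v,N])‖ ≤ (M‖v‖³‖N‖∕2)·t³` — one-variable Taylor (order 2, remainder from the third derivative) for `τ ↦ D¹f(y+τv)[N]`, whose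
`τ`-derivatives are `D²f(y+τv)[v,N]`, `D³f(y+τv)[v,v,N]`, `D⁴f(y+τv)[v,v,v,N]` (★ `hasDerivAt_iteratedFDeriv_apply_line`). [cite: Dieudonne1960, Ch. VIII §14 (8.14.3)] [cite: Rudin1976, Thm. 5.15] -/
theorem norm_iteratedFDeriv_one_sub_taylor_le {f : E → F} {K : Set E} (hK : IsOpen K) (hf : ContDiffOn ℝ 4 f K)
    {M : ℝ} (hM : ∀ y ∈ K, ‖iteratedFDeriv ℝ 4 f y‖ ≤ M) (y v N : E) {t : ℝ} (ht : 0 < t)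
    (hseg : ∀ τ ∈ Icc (0 : ℝ) t, y + τ • v ∈ K) :
    ‖iteratedFDeriv ℝ 1 f (y + t • v) ![N] - (iteratedFDeriv ℝ 1 f y ![N] + t • iteratedFDeriv ℝ 2 f y ![v, N] + (t ^ 2 / 2) • iteratedFDeriv ℝ 3 f y ![v, v, N])‖
      ≤ M * ‖v‖ ^ 3 * ‖N‖ / 2 * t ^ 3 := by
  -- differentiability of the jets on `K`
  have hdA : ∀ {k : ℕ}, k < 4 → ∀ τ : ℝ, y + τ • v ∈ K → DifferentiableAt ℝ (iteratedFDeriv ℝ k f) (y + τ • v) := fun hk τ hτ =>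
    (hf.contDiffAt (hK.mem_nhds hτ)).differentiableAt_iteratedFDeriv (by exact_mod_cast hk)
  -- the line function `φ` and its three derivatives at points of the line inside `K`
  have h1 : ∀ τ : ℝ, y + τ • v ∈ K → HasDerivAt (fun τ : ℝ => iteratedFDeriv ℝ 1 f (y + τ • v) ![N]) (iteratedFDeriv ℝ 2 f (y + τ • v) ![v, N]) τ :=
    fun τ hτ => hasDerivAt_iteratedFDeriv_apply_line f ![N] y v τ (hdA (by norm_num) τ hτ)
  have h2 : ∀ τ : ℝ, y + τ • v ∈ K → HasDerivAt (fun τ : ℝ => iteratedFDeriv ℝ 2 f (y + τ • v) ![v, N]) (iteratedFDeriv ℝ 3 f (y + τ • v) ![v, v, N]) τ :=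
    fun τ hτ => hasDerivAt_iteratedFDeriv_apply_line f ![v, N] y v τ (hdA (by norm_num) τ hτ)
  have h3 : ∀ τ : ℝ, y + τ • v ∈ K → HasDerivAt (fun τ : ℝ => iteratedFDeriv ℝ 3 f (y + τ • v) ![v, v, N]) (iteratedFDeriv ℝ 4 f (y + τ • v) ![v, v, v, N]) τ :=
    fun τ hτ => hasDerivAt_iteratedFDeriv_apply_line f ![v, v, N] y v τ (hdA (by norm_num) τ hτ)
  have hopen : IsOpen {τ : ℝ | y + τ • v ∈ K} := hK.preimage (by fun_prop)
  have hd1 : ∀ τ : ℝ, y + τ • v ∈ K → deriv (fun τ : ℝ => iteratedFDeriv ℝ 1 f (y + τ • v) ![N]) τ = iteratedFDeriv ℝ 2 f (y + τ • v) ![v, N] :=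
    fun τ hτ => (h1 τ hτ).deriv
  have hd2 : ∀ τ : ℝ, y + τ • v ∈ K → iteratedDeriv 2 (fun τ : ℝ => iteratedFDeriv ℝ 1 f (y + τ • v) ![N]) τ = iteratedFDeriv ℝ 3 f (y + τ • v) ![v, v, N] := by
    intro τ hτ
    rw [iteratedDeriv_succ, iteratedDeriv_one]
    have hloc : deriv (fun τ : ℝ => iteratedFDeriv ℝ 1 f (y + τ • v) ![N]) =ᶠ[𝓝 τ] fun τ : ℝ => iteratedFDeriv ℝ 2 f (y + τ • v) ![v, N] := by
      filter_upwards [hopen.mem_nhds hτ] with τ' hτ' using hd1 τ' hτ'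
    rw [hloc.deriv_eq]
    exact (h2 τ hτ).deriv
  have hd3 : ∀ τ : ℝ, y + τ • v ∈ K → iteratedDeriv 3 (fun τ : ℝ => iteratedFDeriv ℝ 1 f (y + τ • v) ![N]) τ = iteratedFDeriv ℝ 4 f (y + τ • v) ![v, v, v, N] := by
    intro τ hτ
    rw [iteratedDeriv_succ]
    have hloc : iteratedDeriv 2 (fun τ : ℝ => iteratedFDeriv ℝ 1 f (y + τ • v) ![N]) =ᶠ[𝓝 τ] fun τ : ℝ => iteratedFDeriv ℝ 3 f (y + τ • v) ![v, v, N] := by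
      filter_upwards [hopen.mem_nhds hτ] with τ' hτ' using hd2 τ' hτ'
    rw [hloc.deriv_eq]
    exact (h3 τ hτ).deriv
  -- `φ` is `C³` at every point of the line inside `K`
  have hφ3 : ∀ τ : ℝ, y + τ • v ∈ K → ContDiffAt ℝ 3 (fun τ : ℝ => iteratedFDeriv ℝ 1 f (y + τ • v) ![N]) τ := by
    intro τ hτ
    have hF : ContDiffAt ℝ 3 (iteratedFDeriv ℝ 1 f) (y + τ • v) :=
      (hf.contDiffAt (hK.mem_nhds hτ)).iteratedFDeriv_right (m := 3) (i := 1) (by norm_num)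
    have hline : ContDiffAt ℝ 3 (fun τ : ℝ => y + τ • v) τ := by fun_prop
    exact (ContinuousMultilinearMap.apply ℝ (fun _ : Fin 1 => E) F ![N]).contDiff.contDiffAt.comp τ (hF.comp τ hline)
  -- Taylor's remainder bound on `[0, t]`
  have hcdo : ContDiffOn ℝ 3 (fun τ : ℝ => iteratedFDeriv ℝ 1 f (y + τ • v) ![N]) (Icc 0 t) := fun τ hτ => (hφ3 τ (hseg τ hτ)).contDiffWithinAt
  have hC : ∀ τ ∈ Icc (0 : ℝ) t, ‖iteratedDerivWithin 3 (fun τ : ℝ => iteratedFDeriv ℝ 1 f (y + τ • v) ![N]) (Icc 0 t) τ‖ ≤ M * ‖v‖ ^ 3 * ‖N‖ := by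
    intro τ hτ
    rw [iteratedDerivWithin_eq_iteratedDeriv (uniqueDiffOn_Icc ht) (hφ3 τ (hseg τ hτ)) hτ, hd3 τ (hseg τ hτ)]
    have hM0 : 0 ≤ M := (norm_nonneg _).trans (hM _ (hseg τ hτ))
    calc ‖iteratedFDeriv ℝ 4 f (y + τ • v) ![v, v, v, N]‖
        ≤ ‖iteratedFDeriv ℝ 4 f (y + τ • v)‖ * ∏ i : Fin 4, ‖(![v, v, v, N] : Fin 4 → E) i‖ := ContinuousMultilinearMap.le_opNorm _ _
      _ = ‖iteratedFDeriv ℝ 4 f (y + τ • v)‖ * (‖v‖ ^ 3 * ‖N‖) := by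
          simp only [Fin.prod_univ_four, Matrix.cons_val_zero, Matrix.cons_val_one, Matrix.cons_val_two, Matrix.cons_val_three,
            Matrix.head_cons, Matrix.tail_cons]
          ring
      _ ≤ M * (‖v‖ ^ 3 * ‖N‖) := by gcongr; exact hM _ (hseg τ hτ)
      _ = M * ‖v‖ ^ 3 * ‖N‖ := by ring
  have htaylor := taylor_mean_remainder_bound (f := fun τ : ℝ => iteratedFDeriv ℝ 1 f (y + τ • v) ![N]) (n := 2) ht.le hcdo (right_mem_Icc.2 ht.le) hC
  -- the Taylor polynomial at `0`
  have h0K : y + (0 : ℝ) • v ∈ K := hseg 0 (left_mem_Icc.2 ht.le)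
  have hT : taylorWithinEval (fun τ : ℝ => iteratedFDeriv ℝ 1 f (y + τ • v) ![N]) 2 (Icc 0 t) 0 t =
      iteratedFDeriv ℝ 1 f y ![N] + t • iteratedFDeriv ℝ 2 f y ![v, N] + (t ^ 2 / 2) • iteratedFDeriv ℝ 3 f y ![v, v, N] := by
    rw [taylor_within_apply]
    simp only [Finset.sum_range_succ, Finset.sum_range_zero, zero_add, sub_zero]
    rw [iteratedDerivWithin_eq_iteratedDeriv (uniqueDiffOn_Icc ht) ((hφ3 0 h0K).of_le (by norm_num)) (left_mem_Icc.2 ht.le),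
      iteratedDerivWithin_eq_iteratedDeriv (uniqueDiffOn_Icc ht) ((hφ3 0 h0K).of_le (by norm_num)) (left_mem_Icc.2 ht.le),
      iteratedDerivWithin_eq_iteratedDeriv (uniqueDiffOn_Icc ht) ((hφ3 0 h0K).of_le (by norm_num)) (left_mem_Icc.2 ht.le),
      iteratedDeriv_zero, iteratedDeriv_one, hd1 0 h0K, hd2 0 h0K]
    simp only [zero_smul, add_zero, Nat.factorial, Nat.cast_one, inv_one, pow_zero, mul_one, one_smul, pow_one, one_mul, Nat.succ_eq_add_one,
      Nat.reduceAdd, Nat.cast_ofNat]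
    rw [show ((2 : ℝ)⁻¹ * t ^ 2) = t ^ 2 / 2 by ring]
  rw [hT] at htaylor
  refine htaylor.trans (le_of_eq ?_)
  simp only [sub_zero, Nat.factorial, Nat.succ_eq_add_one, Nat.reduceAdd, Nat.reduceMul, Nat.cast_ofNat]
  ring

end Taylor

/-! ## §4 A vector polynomial `a + t•b + t²•c` which is `O(t³)` as `t → 0⁺` vanishes -/

section Poly

/-- If `‖a + t•b + t²•c‖ ≤ C·t³` for all `t ∈ (0, δ)` then `a = b = c = 0`. [cite: Rudin1976, Thm. 5.15] -/
theorem eq_zero_of_norm_quadratic_le_cube (a b c : F) {C δ : ℝ} (hδ : 0 < δ)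
    (h : ∀ t ∈ Ioo (0 : ℝ) δ, ‖a + t • b + t ^ 2 • c‖ ≤ C * t ^ 3) : a = 0 ∧ b = 0 ∧ c = 0 := by
  have hC : 0 ≤ C := by
    have h1 := h (δ / 2) ⟨by linarith, by linarith⟩
    have hpos : 0 < (δ / 2) ^ 3 := by positivity
    nlinarith [norm_nonneg (a + (δ / 2) • b + (δ / 2) ^ 2 • c)]
  -- a generic step: `‖x + t•y(t)‖ ≤ ρ(t) → 0` along `t → 0⁺` forces `x = 0`
  have key : ∀ (x : F) (g : ℝ → F) (ρ : ℝ → ℝ), Tendsto ρ (𝓝[>] 0) (𝓝 0) → (∀ t ∈ Ioo (0 : ℝ) δ, ‖x + t • g t‖ ≤ ρ t) →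
      (∃ B : ℝ, ∀ t ∈ Ioo (0 : ℝ) δ, ‖g t‖ ≤ B) → x = 0 := by
    intro x g ρ hρ hle hB
    obtain ⟨B, hB⟩ := hB
    have hB0 : 0 ≤ B := (norm_nonneg _).trans (hB (δ / 2) ⟨by linarith, by linarith⟩)
    have hlim : Tendsto (fun t : ℝ => ρ t + t * B) (𝓝[>] 0) (𝓝 (0 + 0 * B)) :=
      hρ.add ((tendsto_nhdsWithin_of_tendsto_nhds tendsto_id).mul tendsto_const_nhds)
    rw [zero_mul, add_zero] at hlim
    have hev : ∀ᶠ t : ℝ in 𝓝[>] 0, ‖x‖ ≤ ρ t + t * B := by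
      filter_upwards [Ioo_mem_nhdsGT hδ] with t ht
      calc ‖x‖ = ‖(x + t • g t) - t • g t‖ := by rw [add_sub_cancel_right]
        _ ≤ ‖x + t • g t‖ + ‖t • g t‖ := norm_sub_le _ _
        _ ≤ ρ t + t * B := by
            rw [norm_smul, Real.norm_eq_abs, abs_of_pos ht.1]
            exact add_le_add (hle t ht) (mul_le_mul_of_nonneg_left (hB t ht) ht.1.le)
    have h0 : ‖x‖ ≤ 0 := ge_of_tendsto hlim hev
    exact norm_le_zero_iff.1 h0
  -- order 0
  have ha : a = 0 := by
    refine key a (fun t => b + t • c) (fun t => C * t ^ 3) ?_ (fun t ht => ?_) ⟨‖b‖ + δ * ‖c‖, fun t ht => ?_⟩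
    · have hc : Continuous fun t : ℝ => C * t ^ 3 := by fun_prop
      simpa using (hc.tendsto 0).mono_left nhdsWithin_le_nhds
    · have e : a + t • (b + t • c) = a + t • b + t ^ 2 • c := by rw [smul_add, smul_smul, ← add_assoc, sq]
      rw [e]; exact h t ht
    · calc ‖b + t • c‖ ≤ ‖b‖ + ‖t • c‖ := norm_add_le _ _
        _ = ‖b‖ + t * ‖c‖ := by rw [norm_smul, Real.norm_eq_abs, abs_of_pos ht.1]
        _ ≤ ‖b‖ + δ * ‖c‖ := by gcongr; exact ht.2.le
  subst ha
  -- order 1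
  have hb : b = 0 := by
    refine key b (fun t => c) (fun t => C * t ^ 2) ?_ (fun t ht => ?_) ⟨‖c‖, fun t _ => le_rfl⟩
    · have hc : Continuous fun t : ℝ => C * t ^ 2 := by fun_prop
      simpa using (hc.tendsto 0).mono_left nhdsWithin_le_nhds
    · have ht0 : 0 < t := ht.1
      have e : (0 : F) + t • b + t ^ 2 • c = t • (b + t • c) := by rw [zero_add, smul_add, smul_smul, sq]
      have h1 := h t ht
      rw [e, norm_smul, Real.norm_eq_abs, abs_of_pos ht0] at h1
      have h2 : ‖b + t • c‖ ≤ C * t ^ 2 := by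
        have : t * ‖b + t • c‖ ≤ t * (C * t ^ 2) := by nlinarith
        exact le_of_mul_le_mul_left this ht0
      exact h2
  subst hb
  -- order 2
  have hc : c = 0 := by
    refine key c (fun _ => 0) (fun t => C * t) ?_ (fun t ht => ?_) ⟨0, fun t _ => by simp⟩
    · have hc : Continuous fun t : ℝ => C * t := by fun_prop
      simpa using (hc.tendsto 0).mono_left nhdsWithin_le_nhds
    · have ht0 : 0 < t := ht.1
      have h1 := h t ht
      rw [zero_add, smul_zero, zero_add, norm_smul, Real.norm_eq_abs, abs_of_pos (pow_pos ht0 2)] at h1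
      rw [smul_zero, add_zero]
      have : t ^ 2 * ‖c‖ ≤ t ^ 2 * (C * t) := by nlinarith
      exact le_of_mul_le_mul_left this (pow_pos ht0 2)
  exact ⟨rfl, rfl, hc⟩

end Poly

/-! ## §5 Taylor along the wall from a boundary point: the inequality survives in the limit -/

section TaylorLimit

/-- **TAYLOR AT A BOUNDARY POINT, IN THE LIMIT.**  `f` of class `C⁴` on an open `K` with `‖D⁴f‖ ≤ M`; `x₀ ∈ closure K`; for `y ∈ K` near `x₀` the segment `[y, y + t•v]` lies in `K`; the jets
`D¹f, D²f, D³f` tend to `J₁, J₂, J₃` at `x₀` from inside `K` and `D¹f → P` at `x₀ + t•v` from inside `K`.  Then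
`‖P[N] − (J₁[N] + t·J₂[v,N] + (t²∕2)·J₃[v,v,N])‖ ≤ (M‖v‖³‖N‖∕2)·t³` (§3 at `y`, let `y → x₀`). [cite: Dieudonne1960, Ch. VIII §14 (8.14.3)] [cite: WarnerHASSLG2, §8.5.1] -/
theorem norm_sub_taylor_le_of_tendsto {f : E → F} {K : Set E} (hK : IsOpen K) (hf : ContDiffOn ℝ 4 f K)
    {M : ℝ} (hM : ∀ y ∈ K, ‖iteratedFDeriv ℝ 4 f y‖ ≤ M) (v N : E) {t : ℝ} (ht : 0 < t) {x₀ : E} (hx₀ : x₀ ∈ closure K)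
    (hseg : ∀ᶠ y in 𝓝[K] x₀, ∀ τ ∈ Icc (0 : ℝ) t, y + τ • v ∈ K)
    {J₁ : ContinuousMultilinearMap ℝ (fun _ : Fin 1 => E) F} {J₂ : ContinuousMultilinearMap ℝ (fun _ : Fin 2 => E) F}
    {J₃ : ContinuousMultilinearMap ℝ (fun _ : Fin 3 => E) F} {P : ContinuousMultilinearMap ℝ (fun _ : Fin 1 => E) F}
    (hJ₁ : Tendsto (iteratedFDeriv ℝ 1 f) (𝓝[K] x₀) (𝓝 J₁)) (hJ₂ : Tendsto (iteratedFDeriv ℝ 2 f) (𝓝[K] x₀) (𝓝 J₂))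
    (hJ₃ : Tendsto (iteratedFDeriv ℝ 3 f) (𝓝[K] x₀) (𝓝 J₃)) (hP : Tendsto (iteratedFDeriv ℝ 1 f) (𝓝[K] (x₀ + t • v)) (𝓝 P)) :
    ‖P ![N] - (J₁ ![N] + t • J₂ ![v, N] + (t ^ 2 / 2) • J₃ ![v, v, N])‖ ≤ M * ‖v‖ ^ 3 * ‖N‖ / 2 * t ^ 3 := by
  haveI : (𝓝[K] x₀).NeBot := mem_closure_iff_nhdsWithin_neBot.1 hx₀
  have hshift : Tendsto (fun y : E => y + t • v) (𝓝[K] x₀) (𝓝[K] (x₀ + t • v)) := by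
    refine tendsto_nhdsWithin_iff.2 ⟨?_, ?_⟩
    · exact ((continuous_add_const (t • v)).tendsto x₀).mono_left nhdsWithin_le_nhds
    · filter_upwards [hseg] with y hy using hy t (right_mem_Icc.2 ht.le)
  have eP : Tendsto (fun y : E => iteratedFDeriv ℝ 1 f (y + t • v) ![N]) (𝓝[K] x₀) (𝓝 (P ![N])) :=
    ((ContinuousMultilinearMap.apply ℝ (fun _ : Fin 1 => E) F ![N]).continuous.tendsto P).comp (hP.comp hshift)
  have e1 : Tendsto (fun y : E => iteratedFDeriv ℝ 1 f y ![N]) (𝓝[K] x₀) (𝓝 (J₁ ![N])) :=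
    ((ContinuousMultilinearMap.apply ℝ (fun _ : Fin 1 => E) F ![N]).continuous.tendsto J₁).comp hJ₁
  have e2 : Tendsto (fun y : E => iteratedFDeriv ℝ 2 f y ![v, N]) (𝓝[K] x₀) (𝓝 (J₂ ![v, N])) :=
    ((ContinuousMultilinearMap.apply ℝ (fun _ : Fin 2 => E) F ![v, N]).continuous.tendsto J₂).comp hJ₂
  have e3 : Tendsto (fun y : E => iteratedFDeriv ℝ 3 f y ![v, v, N]) (𝓝[K] x₀) (𝓝 (J₃ ![v, v, N])) :=
    ((ContinuousMultilinearMap.apply ℝ (fun _ : Fin 3 => E) F ![v, v, N]).continuous.tendsto J₃).comp hJ₃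
  have hlim : Tendsto (fun y : E => iteratedFDeriv ℝ 1 f (y + t • v) ![N] -
      (iteratedFDeriv ℝ 1 f y ![N] + t • iteratedFDeriv ℝ 2 f y ![v, N] + (t ^ 2 / 2) • iteratedFDeriv ℝ 3 f y ![v, v, N]))
      (𝓝[K] x₀) (𝓝 (P ![N] - (J₁ ![N] + t • J₂ ![v, N] + (t ^ 2 / 2) • J₃ ![v, v, N]))) :=
    eP.sub ((e1.add (e2.const_smul t)).add (e3.const_smul (t ^ 2 / 2)))
  have hbound : ∀ᶠ y in 𝓝[K] x₀, ‖iteratedFDeriv ℝ 1 f (y + t • v) ![N] -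
      (iteratedFDeriv ℝ 1 f y ![N] + t • iteratedFDeriv ℝ 2 f y ![v, N] + (t ^ 2 / 2) • iteratedFDeriv ℝ 3 f y ![v, v, N])‖ ≤ M * ‖v‖ ^ 3 * ‖N‖ / 2 * t ^ 3 := by
    filter_upwards [hseg] with y hy using norm_iteratedFDeriv_one_sub_taylor_le hK hf hM y v N ht hy
  exact le_of_tendsto hlim.norm hbound

end TaylorLimit

/-! ## §6 THE CORNER TRANSFER across a common wall ray, in jet form -/

section Transfer

variable [CompleteSpace F]

/-- **THE CORNER TRANSFER OF THIRD JETS ACROSS A COMMON WALL (jet form).**  `K₁, K₂` open convex bounded, `f` of class `C⁴` with `‖D⁴f‖ ≤ M` on each; the corner `0` and the punctured wall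
ray `t•u`, `t ∈ (0, δ)`, lie in both closures, and near the corner the segments `[y, y + t•u]`, `y ∈ Kᵢ`, stay in `Kᵢ`.  HYPOTHESES ALONG THE PUNCTURED RAY (Harish-Chandra: odd normal
derivatives are continuous across a noncompact wall): any boundary limits `P, Q` of `D¹f` at `t•u` from `K₁`, `K₂` have `P[N] = Q[N]`; any boundary limits of `D³f` there have equal values on
`(N,N,N)`.  CONCLUSION for the CORNER limits `J, J′` of `D³f` from `K₁`, `K₂`: `J[N,N,N] = J′[N,N,N]` and `J[u,u,N] = J′[u,u,N]`.  (No extension of `f` beyond `Kᵢ` is used.)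
[cite: WarnerHASSLG2, §8.5.1 proof of Thm. 8.5.1.9] [cite: Dieudonne1960, Ch. VIII §14 (8.14.3)] -/
theorem cornerJet_transfer {f : E → F} {K₁ K₂ : Set E} (hK₁ : IsOpen K₁) (hK₁c : Convex ℝ K₁) (hK₂ : IsOpen K₂) (hK₂c : Convex ℝ K₂)
    {R : ℝ} (hR₁ : ∀ x ∈ K₁, ∀ y ∈ K₁, ‖y - x‖ ≤ R) (hR₂ : ∀ x ∈ K₂, ∀ y ∈ K₂, ‖y - x‖ ≤ R)
    (hf₁ : ContDiffOn ℝ 4 f K₁) (hf₂ : ContDiffOn ℝ 4 f K₂) {M : ℝ} (hM₁ : ∀ y ∈ K₁, ‖iteratedFDeriv ℝ 4 f y‖ ≤ M) (hM₂ : ∀ y ∈ K₂, ‖iteratedFDeriv ℝ 4 f y‖ ≤ M)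
    (h0₁ : (0 : E) ∈ closure K₁) (h0₂ : (0 : E) ∈ closure K₂) (u N : E) {δ : ℝ} (hδ : 0 < δ)
    (hwall₁ : ∀ t ∈ Ioo (0 : ℝ) δ, t • u ∈ closure K₁) (hwall₂ : ∀ t ∈ Ioo (0 : ℝ) δ, t • u ∈ closure K₂)
    (hseg₁ : ∀ t ∈ Ioo (0 : ℝ) δ, ∀ᶠ y in 𝓝[K₁] 0, ∀ τ ∈ Icc (0 : ℝ) t, y + τ • u ∈ K₁)
    (hseg₂ : ∀ t ∈ Ioo (0 : ℝ) δ, ∀ᶠ y in 𝓝[K₂] 0, ∀ τ ∈ Icc (0 : ℝ) t, y + τ • u ∈ K₂)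
    (hfirst : ∀ t ∈ Ioo (0 : ℝ) δ, ∀ P Q : ContinuousMultilinearMap ℝ (fun _ : Fin 1 => E) F,
      Tendsto (iteratedFDeriv ℝ 1 f) (𝓝[K₁] (t • u)) (𝓝 P) → Tendsto (iteratedFDeriv ℝ 1 f) (𝓝[K₂] (t • u)) (𝓝 Q) → P ![N] = Q ![N])
    (hthird : ∀ t ∈ Ioo (0 : ℝ) δ, ∀ P Q : ContinuousMultilinearMap ℝ (fun _ : Fin 3 => E) F,
      Tendsto (iteratedFDeriv ℝ 3 f) (𝓝[K₁] (t • u)) (𝓝 P) → Tendsto (iteratedFDeriv ℝ 3 f) (𝓝[K₂] (t • u)) (𝓝 Q) → P ![N, N, N] = Q ![N, N, N])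
    {J J' : ContinuousMultilinearMap ℝ (fun _ : Fin 3 => E) F}
    (hJ : Tendsto (iteratedFDeriv ℝ 3 f) (𝓝[K₁] 0) (𝓝 J)) (hJ' : Tendsto (iteratedFDeriv ℝ 3 f) (𝓝[K₂] 0) (𝓝 J')) :
    J ![N, N, N] = J' ![N, N, N] ∧ J ![u, u, N] = J' ![u, u, N] := by
  -- bounds on `D¹f … D⁴f` on both regions, hence boundary limits of `D⁰f … D³f` everywhere on the closures
  have hb₁ := exists_bound_iteratedFDeriv_of_le (n := 4) hK₁ hK₁c hR₁ hf₁ hM₁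
  have hb₂ := exists_bound_iteratedFDeriv_of_le (n := 4) hK₂ hK₂c hR₂ hf₂ hM₂
  have hlim₁ : ∀ k : ℕ, k < 4 → ∀ x ∈ closure K₁, ∃ L : ContinuousMultilinearMap ℝ (fun _ : Fin k => E) F, Tendsto (iteratedFDeriv ℝ k f) (𝓝[K₁] x) (𝓝 L) := by
    intro k hk x hx
    obtain ⟨M', hM'⟩ := hb₁ (k + 1) (Nat.succ_le_of_lt hk)
    exact exists_tendsto_iteratedFDeriv_nhdsWithin_closure hK₁ hK₁c (hf₁.of_le (by exact_mod_cast (by omega : k + 1 ≤ 4))) hM' hx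
  have hlim₂ : ∀ k : ℕ, k < 4 → ∀ x ∈ closure K₂, ∃ L : ContinuousMultilinearMap ℝ (fun _ : Fin k => E) F, Tendsto (iteratedFDeriv ℝ k f) (𝓝[K₂] x) (𝓝 L) := by
    intro k hk x hx
    obtain ⟨M', hM'⟩ := hb₂ (k + 1) (Nat.succ_le_of_lt hk)
    exact exists_tendsto_iteratedFDeriv_nhdsWithin_closure hK₂ hK₂c (hf₂.of_le (by exact_mod_cast (by omega : k + 1 ≤ 4))) hM' hx
  -- the wall ray tends to the corner within the closures
  have hray : ∀ {S : Set E}, (∀ t ∈ Ioo (0 : ℝ) δ, t • u ∈ S) → Tendsto (fun t : ℝ => t • u) (𝓝[>] 0) (𝓝[S] 0) := by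
    intro S hS
    refine tendsto_nhdsWithin_iff.2 ⟨?_, ?_⟩
    · have hc : Continuous fun t : ℝ => t • u := continuous_id.smul continuous_const
      simpa only [zero_smul] using (hc.tendsto 0).mono_left nhdsWithin_le_nhds
    · filter_upwards [Ioo_mem_nhdsGT hδ] with t ht using hS t ht
  constructor
  · -- (N,N,N): continuity of `extendFrom Kᵢ (D³f)` at the corner along the ray
    have hc₁ : ContinuousOn (extendFrom K₁ (iteratedFDeriv ℝ 3 f)) (closure K₁) := continuousOn_extendFrom subset_rfl (hlim₁ 3 (by norm_num))
    have hc₂ : ContinuousOn (extendFrom K₂ (iteratedFDeriv ℝ 3 f)) (closure K₂) := continuousOn_extendFrom subset_rfl (hlim₂ 3 (by norm_num))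
    have hE₁ : extendFrom K₁ (iteratedFDeriv ℝ 3 f) 0 = J := extendFrom_eq h0₁ hJ
    have hE₂ : extendFrom K₂ (iteratedFDeriv ℝ 3 f) 0 = J' := extendFrom_eq h0₂ hJ'
    have hT₁ : Tendsto (fun t : ℝ => extendFrom K₁ (iteratedFDeriv ℝ 3 f) (t • u) ![N, N, N]) (𝓝[>] 0) (𝓝 (J ![N, N, N])) := by
      have h := ((hc₁ 0 h0₁).tendsto.comp (hray hwall₁))
      rw [hE₁] at h
      exact ((ContinuousMultilinearMap.apply ℝ (fun _ : Fin 3 => E) F ![N, N, N]).continuous.tendsto J).comp h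
    have hT₂ : Tendsto (fun t : ℝ => extendFrom K₂ (iteratedFDeriv ℝ 3 f) (t • u) ![N, N, N]) (𝓝[>] 0) (𝓝 (J' ![N, N, N])) := by
      have h := ((hc₂ 0 h0₂).tendsto.comp (hray hwall₂))
      rw [hE₂] at h
      exact ((ContinuousMultilinearMap.apply ℝ (fun _ : Fin 3 => E) F ![N, N, N]).continuous.tendsto J').comp h
    have heq : (fun t : ℝ => extendFrom K₁ (iteratedFDeriv ℝ 3 f) (t • u) ![N, N, N]) =ᶠ[𝓝[>] 0]
        (fun t : ℝ => extendFrom K₂ (iteratedFDeriv ℝ 3 f) (t • u) ![N, N, N]) := by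
      filter_upwards [Ioo_mem_nhdsGT hδ] with t ht
      exact hthird t ht _ _ (tendsto_extendFrom (hlim₁ 3 (by norm_num) _ (hwall₁ t ht))) (tendsto_extendFrom (hlim₂ 3 (by norm_num) _ (hwall₂ t ht)))
    exact tendsto_nhds_unique_of_eventuallyEq hT₁ hT₂ heq
  · -- (u,u,N): Taylor along the wall from the corner on both sides, subtract, §4
    obtain ⟨J₁, hJ₁⟩ := hlim₁ 1 (by norm_num) 0 h0₁
    obtain ⟨J₂, hJ₂⟩ := hlim₁ 2 (by norm_num) 0 h0₁
    obtain ⟨J₁', hJ₁'⟩ := hlim₂ 1 (by norm_num) 0 h0₂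
    obtain ⟨J₂', hJ₂'⟩ := hlim₂ 2 (by norm_num) 0 h0₂
    have hpoly : ∀ t ∈ Ioo (0 : ℝ) δ, ‖(J₁ ![N] - J₁' ![N]) + t • (J₂ ![u, N] - J₂' ![u, N]) + t ^ 2 • ((1 / 2 : ℝ) • (J ![u, u, N] - J' ![u, u, N]))‖
        ≤ (M * ‖u‖ ^ 3 * ‖N‖ / 2 + M * ‖u‖ ^ 3 * ‖N‖ / 2) * t ^ 3 := by
      intro t ht
      obtain ⟨P, hP⟩ := hlim₁ 1 (by norm_num) _ (hwall₁ t ht)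
      obtain ⟨Q, hQ⟩ := hlim₂ 1 (by norm_num) _ (hwall₂ t ht)
      have hPQ : P ![N] = Q ![N] := hfirst t ht P Q hP hQ
      have h₁ := norm_sub_taylor_le_of_tendsto hK₁ hf₁ hM₁ u N ht.1 h0₁ (hseg₁ t ht) hJ₁ hJ₂ hJ (by simpa only [zero_add] using hP)
      have h₂ := norm_sub_taylor_le_of_tendsto hK₂ hf₂ hM₂ u N ht.1 h0₂ (hseg₂ t ht) hJ₁' hJ₂' hJ' (by simpa only [zero_add] using hQ)
      have e : (J₁ ![N] - J₁' ![N]) + t • (J₂ ![u, N] - J₂' ![u, N]) + t ^ 2 • ((1 / 2 : ℝ) • (J ![u, u, N] - J' ![u, u, N])) =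
          (Q ![N] - (J₁' ![N] + t • J₂' ![u, N] + (t ^ 2 / 2) • J' ![u, u, N])) - (P ![N] - (J₁ ![N] + t • J₂ ![u, N] + (t ^ 2 / 2) • J ![u, u, N])) := by
        rw [hPQ]
        simp only [smul_sub, smul_smul]
        rw [show t ^ 2 * (1 / 2 : ℝ) = t ^ 2 / 2 by ring]
        abel
      rw [e, add_mul]
      exact (norm_sub_le _ _).trans (add_le_add h₂ h₁)
    obtain ⟨-, -, hc⟩ := eq_zero_of_norm_quadratic_le_cube _ _ _ hδ hpoly
    have h2 : (J ![u, u, N] - J' ![u, u, N]) = 0 := by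
      have := congrArg (fun x : F => (2 : ℝ) • x) hc
      simpa only [smul_smul, smul_zero, show (2 : ℝ) * (1 / 2) = 1 by norm_num, one_smul] using this
    exact sub_eq_zero.1 h2

end Transfer

end Literature.Analysis.Calculus

end
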